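import Mathlib.Algebra.Group.Commutator
import Mathlib.GroupTheory.Abelianization.Defs
import Mathlib.GroupTheory.Commutator.Basic
import Mathlib.GroupTheory.QuotientGroup.Basic
import Mathlib.Tactic.Group
import HarnessLib

/-!
# Hopf's formula, the two elementary lemmas: lifts agree modulo `[P', N']` on commutators, and
# `⟪r⟫ / [P, ⟪r⟫]` is cyclic

Topic `Literature/GroupTheory/CombinatorialGroupTheory`; theorems only.  For a presentation
`Γ = P / N` Hopf's formula reads `H₂(Γ; ℤ) ≅ (N ∩ [P, P]) / [P, N]` (K. S. Brown, *Cohomology of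
Groups*, II §5, Thm. 5.3; H. Hopf, *Fundamentalgruppe und zweite Bettische Gruppe*, Comment. Math.
Helv. 14 (1942) 257–309).  We do not build `H₂`; we prove the two group-theoretic facts that make the
right-hand side functorial and computable, in membership form:

* `QuotientGroup.mk_eq_mk_of_lifts` — if `θ₁, θ₂ : P →* P'` agree modulo a normal subgroup `N'`
  (`θ₁ x ≡ θ₂ x mod N'` for all `x`), then they agree modulo `⁅⊤, N'⁆ = [P', N']` on the commutator
  subgroup `[P, P]` (Brown II §5, proof of Thm. 5.3 / Ex. 5.4: "`x ↦ θ₁(x)⁻¹ θ₂(x)` is a homomorphism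
  into the central subgroup `N'/[P',N']` of `P'/[P',N']`, hence kills commutators");
* `QuotientGroup.exists_mk_eq_mk_zpow_of_mem_normalClosure` — for one relator `r`, every element of
  the normal closure `N = ⟪r⟫` is congruent to a power `r^k` modulo `[P, N]` (the conjugates
  `g r g⁻¹` that generate `N` all reduce to `r`, which is central in `P/[P,N]`);
* `Subgroup.map_commutator_top_le` — a homomorphism carrying `N` into `N'` carries `[P, N]` into
  `[P', N']` (functoriality).

Used by the surface-group covering-degree computation (`SurfaceGroupCoveringDegree.lean`): two lifts
`F_h → F_g`, `F_g ⊇ E → F_h` of an isomorphism of presented groups are mutually inverse on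
`(N ∩ [P,P]) / [P,N]`.  Classical; no new definitions.
-/

namespace Literature.GroupTheory.CombinatorialGroupTheory

open Subgroup
open scoped commutatorElement

universe u v

variable {P : Type u} [Group P] {P' : Type v} [Group P']

/-! ### Functoriality: `θ [P, N] ⊆ [P', N']` -/

/-- A homomorphism `θ` with `θ(N) ⊆ N'` maps `[P, N] = ⁅⊤, N⁆` into `[P', N'] = ⁅⊤, N'⁆`.
[cite: Brown1982CohomologyGroups, II §5 Thm 5.3] -/
theorem Subgroup.map_commutator_top_le (θ : P →* P') {N : Subgroup P} {N' : Subgroup P'}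
    (hN : N.map θ ≤ N') : (⁅(⊤ : Subgroup P), N⁆).map θ ≤ ⁅(⊤ : Subgroup P'), N'⁆ := by
  rw [Subgroup.map_commutator]
  exact Subgroup.commutator_mono le_top hN

/-! ### In `P / [P, N]` the image of `N` is central -/

/-- For `n ∈ N` and any `y`, the images of `y` and `n` commute in `P / ⁅⊤, N⁆`.
[cite: Brown1982CohomologyGroups, II §5 Thm 5.3] -/
theorem QuotientGroup.mk_mul_mk_comm_of_mem (N : Subgroup P) [N.Normal] {n : P} (hn : n ∈ N)
    (y : P) :
    (QuotientGroup.mk (s := ⁅(⊤ : Subgroup P), N⁆) y : P ⧸ ⁅(⊤ : Subgroup P), N⁆) *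
        QuotientGroup.mk n =
      QuotientGroup.mk n * QuotientGroup.mk y := by
  rw [← QuotientGroup.mk_mul, ← QuotientGroup.mk_mul, QuotientGroup.eq]
  -- `(y n)⁻¹ (n y) = n⁻¹ y⁻¹ n y = ⁅n⁻¹, y⁻¹⁆`, a commutator of an element of `N` with one of `P`
  have h : (y * n)⁻¹ * (n * y) = ⁅n⁻¹, y⁻¹⁆ := by
    rw [commutatorElement_def]; group
  rw [h, ← Subgroup.commutator_comm]
  exact Subgroup.commutator_mem_commutator (N.inv_mem hn) (Subgroup.mem_top _)

/-- The image of `N` in `P / ⁅⊤, N⁆` lies in the centre. [cite: Brown1982CohomologyGroups, II §5 Thm 5.3] -/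
theorem QuotientGroup.mk_mem_center_of_mem (N : Subgroup P) [N.Normal] {n : P} (hn : n ∈ N) :
    (QuotientGroup.mk (s := ⁅(⊤ : Subgroup P), N⁆) n : P ⧸ ⁅(⊤ : Subgroup P), N⁆) ∈
      Subgroup.center (P ⧸ ⁅(⊤ : Subgroup P), N⁆) := by
  rw [Subgroup.mem_center_iff]
  intro q
  induction q using QuotientGroup.induction_on with
  | H y => exact QuotientGroup.mk_mul_mk_comm_of_mem N hn y

/-! ### Two lifts of one homomorphism agree on `[P, P]` modulo `[P', N']` -/

/-- **Hopf's lemma on lifts.**  Let `N' ⊴ P'` and let `θ₁, θ₂ : P →* P'` agree modulo `N'`, i.e.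
`θ₁(x)⁻¹ θ₂(x) ∈ N'` for every `x` (two lifts to `P'` of the same homomorphism `P → P'/N'`).  Then
for every `x` in the commutator subgroup `[P, P]` the two values agree modulo `[P', N'] = ⁅⊤, N'⁆`:
`θ₁(x)⁻¹ θ₂(x) ∈ ⁅⊤, N'⁆`.  (The function `x ↦ θ₁(x)⁻¹θ₂(x)` is, modulo `⁅⊤, N'⁆`, a homomorphism
into the centre, hence vanishes on commutators.)  This is the step that makes Hopf's
`(N ∩ [P,P])/[P,N]` independent of the chosen lift. [cite: Brown1982CohomologyGroups, II §5 Thm 5.3] -/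
theorem QuotientGroup.mk_eq_mk_of_lifts (N' : Subgroup P') [N'.Normal] (θ₁ θ₂ : P →* P')
    (h : ∀ x, (θ₁ x)⁻¹ * θ₂ x ∈ N') {x : P} (hx : x ∈ commutator P) :
    (θ₁ x)⁻¹ * θ₂ x ∈ ⁅(⊤ : Subgroup P'), N'⁆ := by
  -- the centre-valued homomorphism `u`
  let C : Subgroup P' := ⁅(⊤ : Subgroup P'), N'⁆
  let π : P' →* P' ⧸ C := QuotientGroup.mk' C
  have hcentral : ∀ x, π ((θ₁ x)⁻¹ * θ₂ x) ∈ Subgroup.center (P' ⧸ C) := fun x =>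
    QuotientGroup.mk_mem_center_of_mem N' (h x)
  let u : P →* P' ⧸ C :=
    { toFun := fun x => π ((θ₁ x)⁻¹ * θ₂ x)
      map_one' := by simp only [map_one, inv_one, mul_one]
      map_mul' := fun x y => by
        simp only [map_mul, map_inv, mul_inv_rev]
        -- `π(θ₁ y)⁻¹ · [π(θ₁ x)⁻¹ π(θ₂ x)] · π(θ₂ y)`, and the bracket is central
        have hc := Subgroup.mem_center_iff.mp (hcentral x) (π (θ₁ y))⁻¹
        rw [map_mul, map_inv] at hc
        calc (π (θ₁ y))⁻¹ * (π (θ₁ x))⁻¹ * (π (θ₂ x) * π (θ₂ y))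
            = (π (θ₁ y))⁻¹ * ((π (θ₁ x))⁻¹ * π (θ₂ x)) * π (θ₂ y) := by simp only [mul_assoc]
          _ = (π (θ₁ x))⁻¹ * π (θ₂ x) * (π (θ₁ y))⁻¹ * π (θ₂ y) := by rw [hc]
          _ = (π (θ₁ x))⁻¹ * π (θ₂ x) * ((π (θ₁ y))⁻¹ * π (θ₂ y)) := by simp only [mul_assoc] }
  have hu_apply : ∀ x, u x = π ((θ₁ x)⁻¹ * θ₂ x) := fun x => rfl
  -- a homomorphism with central values kills the commutator subgroup
  have hker : commutator P ≤ u.ker := by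
    rw [commutator_def, Subgroup.commutator_le]
    intro a _ b _
    rw [MonoidHom.mem_ker, map_commutatorElement, commutatorElement_eq_one_iff_mul_comm]
    exact (Subgroup.mem_center_iff.mp (hu_apply a ▸ hcentral a) (u b)).symm
  have hval : π ((θ₁ x)⁻¹ * θ₂ x) = 1 := by
    rw [← hu_apply, ← MonoidHom.mem_ker]
    exact hker hx
  rwa [QuotientGroup.mk'_apply, QuotientGroup.eq_one_iff] at hval

/-- The same, in the quotient: `θ₁ x = θ₂ x` in `P' / ⁅⊤, N'⁆` for `x ∈ [P, P]`.
[cite: Brown1982CohomologyGroups, II §5 Thm 5.3] -/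
theorem QuotientGroup.mk_lift_eq_mk_lift (N' : Subgroup P') [N'.Normal] (θ₁ θ₂ : P →* P')
    (h : ∀ x, (θ₁ x)⁻¹ * θ₂ x ∈ N') {x : P} (hx : x ∈ commutator P) :
    (QuotientGroup.mk (s := ⁅(⊤ : Subgroup P'), N'⁆) (θ₁ x) : P' ⧸ ⁅(⊤ : Subgroup P'), N'⁆) =
      QuotientGroup.mk (θ₂ x) := by
  rw [QuotientGroup.eq]
  exact QuotientGroup.mk_eq_mk_of_lifts N' θ₁ θ₂ h hx

/-! ### One relator: `⟪r⟫ / [P, ⟪r⟫]` is cyclic, generated by `r` -/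

/-- The relator is central in `P / [P, ⟪r⟫]`. [cite: Brown1982CohomologyGroups, II §5 Ex 5.4] -/
theorem QuotientGroup.mk_relator_mem_center (r : P) :
    (QuotientGroup.mk (s := ⁅(⊤ : Subgroup P), normalClosure ({r} : Set P)⁆) r :
        P ⧸ ⁅(⊤ : Subgroup P), normalClosure ({r} : Set P)⁆) ∈
      Subgroup.center (P ⧸ ⁅(⊤ : Subgroup P), normalClosure ({r} : Set P)⁆) :=
  QuotientGroup.mk_mem_center_of_mem _ (subset_normalClosure (Set.mem_singleton r))

/-- **`⟪r⟫ / [P, ⟪r⟫]` is cyclic on `r`.**  Every element of the normal closure `N = ⟪r⟫` of a single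
relator is congruent, modulo `[P, N] = ⁅⊤, N⁆`, to a power of `r`: the conjugates `g r^{±1} g⁻¹`
generating `N` reduce to `r^{±1}` because `r` is central modulo `[P, N]`.  (So for a one-relator
presentation with `r ∈ [P, P]`, Hopf's `H₂ = N/[P,N]` is cyclic, generated by the class of `r`.)
[cite: Brown1982CohomologyGroups, II §5 Ex 5.4] -/
theorem QuotientGroup.exists_mk_eq_mk_zpow_of_mem_normalClosure (r : P) {x : P}
    (hx : x ∈ normalClosure ({r} : Set P)) :
    ∃ k : ℤ, (QuotientGroup.mk (s := ⁅(⊤ : Subgroup P), normalClosure ({r} : Set P)⁆) x :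
        P ⧸ ⁅(⊤ : Subgroup P), normalClosure ({r} : Set P)⁆) = QuotientGroup.mk (r ^ k) := by
  let C : Subgroup P := ⁅(⊤ : Subgroup P), normalClosure ({r} : Set P)⁆
  let π : P →* P ⧸ C := QuotientGroup.mk' C
  -- the image of `N` under `π` is contained in `zpowers (π r)`, a normal subgroup (central generator)
  have hcen : π r ∈ Subgroup.center (P ⧸ C) := QuotientGroup.mk_relator_mem_center r
  haveI : (Subgroup.zpowers (π r)).Normal := by
    refine ⟨fun y hy g => ?_⟩
    have hyc : y ∈ Subgroup.center (P ⧸ C) :=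
      (Subgroup.zpowers_le.mpr hcen : Subgroup.zpowers (π r) ≤ _) hy
    rw [Subgroup.mem_center_iff.mp hyc g, mul_inv_cancel_right]
    exact hy
  have hle : (normalClosure ({r} : Set P)).map π ≤ Subgroup.zpowers (π r) := by
    rw [Subgroup.map_le_iff_le_comap]
    refine normalClosure_le_normal ?_
    rintro _ ⟨⟩
    exact Subgroup.mem_zpowers (π r)
  obtain ⟨k, hk⟩ := Subgroup.mem_zpowers_iff.mp (hle ⟨x, hx, rfl⟩)
  refine ⟨k, ?_⟩
  change π x = π (r ^ k)
  rw [map_zpow, hk]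

end Literature.GroupTheory.CombinatorialGroupTheory
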